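import Mathlib
import Summits.AtomisticToContinuum.Crystallization.Theorems.SquareWellLayerCakeGapTwelveToBarlowNoSixCommonNeighbours
import Summits.AtomisticToContinuum.Crystallization.Theorems.SquareWellLayerCakeGapTwelveToBarlowExtendedGapCone

/-!
# The face-cone certificate and the reduction of `stub_extendedGap` to `LinkConesCover`

Crux `SquareWellLayerCake.GapTwelveToBarlow` (item stmt-AtomisticToContinuum-15807), line
`Sketch`, stub `stub_extendedGap` ("tolerant Lemma 2": four-deep inside an all-Good region no two
sites are at distance in `(1, 131/100)`).

* `le_dist_of_cone_four_cycle` (**face-cone certificate**, the one-deep half of the stub): let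
  `a, b, c, d` be link vertices of `p` (`|px| ∈ [55/57, 1]`) forming a bonded closed walk
  (`|ab|, |bc|, |cd|, |da| ≤ 1`; `d = c` is a bonded triangle, `le_dist_of_cone_triangle`), and let
  `q − p = α(a − p) + β(b − p) + γ(c − p) + δ(d − p)` with `α, β, γ, δ ≥ 0` (closed cone of `p` over
  the walk).  If `|qa|, |qb|, |qc|, |qd| ≥ 55/57` and `|pq| > 1` then `|pq| ≥ 131/100`.  No
  separation inside the walk, no diagonal and no dichotomy hypothesis on `|qx|` is needed: the
  extremal motif is the tolerant octahedron (threshold `|pq|² < 4(55/57)² − 2`, `|pq| < 1.3131`;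
  numerically the triangle case is `≥ 1.55`, a vertex with `|qx| ≥ 11/10` gives `≥ 1.36`).
* `stub_extendedGapOfLinkConesCover` (**reduction**): the registered signature of
  `stub_extendedGap` follows from `LinkConesCover` — four-deep (every site within `4` of `x i`
  Good), every site `x j` with `1 < |x i − x j| < 2` lies in the closed cone of `x i` over a bonded
  closed 4-walk of the link of `i`.  `LinkConesCover` is the multi-shell core of the stub (one-deep
  it is false: zoo links have faces up to 14-gons); in the `T/O/D5h` links (cuboctahedron,
  anticuboctahedron, bicapped pentagonal prism) every face is a 3- or 4-cycle and the face cones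
  tile space.  Only Good(`i`) is consumed by the reduction itself.

## Proof of the certificate

`t = |pq| ∈ (1, 131/100)`, `e = (q − p)/t`, `σ_x = ⟪x − p, e⟫`, `P_x = x − p − σ_x e` (the frame of
`…ExtendedGapFourCycle`).  The cone relation splits into `αP_a + βP_b + γP_c + δP_d = 0` and
`Σ ασ_a = t`, whence `α + β + γ + δ > 0` (`σ_x ≤ |px| ≤ 1`).  Each side of the walk has
`⟪P_x, P_y⟫ > 0` (`side_inner_pos`; the case `σ_x, σ_y < 0` is excluded by `cross_neg_false` fed
with `tσ_x = Σ_z w_z⟪z − p, x − p⟫`, the side bounds `⟪x−p, y−p⟫ ≥ (2(55/57)² − 1)/2` and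
`⟪a−p, c−p⟫ + ⟪b−p, d−p⟫ ≥ 2(55/57)² − 2`), and in the plane `e^⊥ ≅ ℂ`
(`OrthonormalBasis.fromOrthogonalSpanSingleton` + `Complex.isometryOfOrthonormal`) this contradicts
`planar_four_cone_false`.  Mathlib + the landed `norm_add_smul_sq_of_inner_eq_zero`,
`planar_four_cone_false`, `side_inner_pos`, `cross_neg_false`; no named fact is used.
-/

noncomputable section

namespace Summit.AtomisticToContinuum.Crystallization.Theorems.SquareWellLayerCakeGapTwelveToBarlow

open scoped InnerProductSpace ComplexConjugate Real

/-! ## The face-cone certificate -/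

/-- **Face-cone certificate** (one-deep half of `stub_extendedGap`).  Let `a, b, c, d` be link
vertices of `p` (`55/57 ≤ |px| ≤ 1`) forming a bonded closed walk (`|ab|, |bc|, |cd|, |da| ≤ 1`;
`d = c` is allowed and gives a bonded triangle), and let `q` lie in the closed cone of `p` over
them: `q − p = α(a − p) + β(b − p) + γ(c − p) + δ(d − p)`, `α, β, γ, δ ≥ 0`.  If `q` keeps the hard
core from the four vertices (`|qx| ≥ 55/57`) and `1 < |pq|`, then `131/100 ≤ |pq|`.  (Threshold of
the argument: `|pq|² < 4(55/57)² − 2`, the tolerant octahedron; no separation, diagonal or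
dichotomy hypothesis is used.) [folklore] -/
theorem le_dist_of_cone_four_cycle (p q a b c d : EuclideanSpace ℝ (Fin 3)) (α β γ δ : ℝ)
    (hα : 0 ≤ α) (hβ : 0 ≤ β) (hγ : 0 ≤ γ) (hδ : 0 ≤ δ)
    (hcone : q - p = α • (a - p) + β • (b - p) + γ • (c - p) + δ • (d - p))
    (hpq : 1 < dist p q)
    (hpa : dist p a ≤ 1) (hpb : dist p b ≤ 1) (hpc : dist p c ≤ 1) (hpd : dist p d ≤ 1)
    (lpa : 55 / 57 ≤ dist p a) (lpb : 55 / 57 ≤ dist p b) (lpc : 55 / 57 ≤ dist p c)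
    (lpd : 55 / 57 ≤ dist p d)
    (hab : dist a b ≤ 1) (hbc : dist b c ≤ 1) (hcd : dist c d ≤ 1) (hda : dist d a ≤ 1)
    (lqa : 55 / 57 ≤ dist q a) (lqb : 55 / 57 ≤ dist q b) (lqc : 55 / 57 ≤ dist q c)
    (lqd : 55 / 57 ≤ dist q d) :
    131 / 100 ≤ dist p q := by
  by_contra! hlt
  -- the axis
  obtain ⟨t, ht⟩ : ∃ t : ℝ, t = dist p q := ⟨_, rfl⟩
  rw [← ht] at hpq hlt
  have htpos : 0 < t := by linarith
  have hnorm_qp : ‖q - p‖ = t := by rw [ht, dist_eq_norm, norm_sub_rev]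
  obtain ⟨e, he⟩ : ∃ e : EuclideanSpace ℝ (Fin 3), e = t⁻¹ • (q - p) := ⟨_, rfl⟩
  have he1 : ‖e‖ = 1 := by
    rw [he, norm_smul, norm_inv, Real.norm_eq_abs, abs_of_pos htpos, hnorm_qp,
      inv_mul_cancel₀ htpos.ne']
  have hee : ⟪e, e⟫_ℝ = 1 := by rw [real_inner_self_eq_norm_sq, he1, one_pow]
  have hqp : q - p = t • e := by rw [he, smul_smul, mul_inv_cancel₀ htpos.ne', one_smul]
  -- axial coordinates `σ` and transversal parts `P`
  obtain ⟨σ, hσ⟩ : ∃ σ : EuclideanSpace ℝ (Fin 3) → ℝ, ∀ x, σ x = ⟪x - p, e⟫_ℝ :=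
    ⟨_, fun _ => rfl⟩
  obtain ⟨P, hP⟩ : ∃ P : EuclideanSpace ℝ (Fin 3) → EuclideanSpace ℝ (Fin 3),
      ∀ x, P x = x - p - σ x • e := ⟨_, fun _ => rfl⟩
  have hPe : ∀ x, ⟪P x, e⟫_ℝ = 0 := by
    intro x
    rw [hP, inner_sub_left, real_inner_smul_left, hee, ← hσ x]
    ring
  have hxp : ∀ x, x - p = P x + σ x • e := fun x => by rw [hP, sub_add_cancel]
  have hxq : ∀ x, x - q = P x + (σ x - t) • e := fun x => by
    rw [hP, sub_smul, ← hqp]; abel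
  have hxy : ∀ x y, x - y = (P x - P y) + (σ x - σ y) • e := fun x y => by
    rw [hP, hP, sub_smul]; abel
  have hA : ∀ x, ‖x - p‖ ^ 2 = ‖P x‖ ^ 2 + σ x ^ 2 := fun x => by
    rw [hxp]; exact norm_add_smul_sq_of_inner_eq_zero he1 (hPe x) _
  have hB : ∀ x, ‖x - q‖ ^ 2 = ‖P x‖ ^ 2 + (σ x - t) ^ 2 := fun x => by
    rw [hxq]; exact norm_add_smul_sq_of_inner_eq_zero he1 (hPe x) _
  have hD : ∀ x y, ‖x - y‖ ^ 2 = ‖P x - P y‖ ^ 2 + (σ x - σ y) ^ 2 := fun x y => by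
    rw [hxy]
    exact norm_add_smul_sq_of_inner_eq_zero he1 (by rw [inner_sub_left, hPe, hPe, sub_zero]) _
  have h2σ : ∀ x, 2 * t * σ x = ‖x - p‖ ^ 2 + t ^ 2 - ‖x - q‖ ^ 2 := fun x => by
    rw [hA x, hB x]; ring
  have hip : ∀ x y, 2 * ⟪P x, P y⟫_ℝ =
      ‖x - p‖ ^ 2 + ‖y - p‖ ^ 2 - ‖x - y‖ ^ 2 - 2 * (σ x * σ y) := by
    intro x y
    rw [hD x y, hA x, hA y, norm_sub_sq_real]
    ring
  -- the cone relation, projected onto `e^⊥` and onto `e`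
  have hV : α • P a + β • P b + γ • P c + δ • P d =
      (t - (α * σ a + β * σ b + γ * σ c + δ * σ d)) • e := by
    have h1 : t • e = α • (P a + σ a • e) + β • (P b + σ b • e) + γ • (P c + σ c • e) +
        δ • (P d + σ d • e) := by
      rw [← hxp a, ← hxp b, ← hxp c, ← hxp d, ← hqp, hcone]
    rw [sub_smul, h1]
    module
  have hS : α * σ a + β * σ b + γ * σ c + δ * σ d = t := by
    have h1 : ⟪α • P a + β • P b + γ • P c + δ • P d, e⟫_ℝ = 0 := by
      simp only [inner_add_left, real_inner_smul_left, hPe, mul_zero, add_zero]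
    rw [hV, real_inner_smul_left, hee, mul_one] at h1
    linarith
  have hV0 : α • P a + β • P b + γ • P c + δ • P d = 0 := by
    rw [hV, hS, sub_self, zero_smul]
  -- the weights do not all vanish
  have hσle : ∀ x, dist p x ≤ 1 → σ x ≤ 1 := by
    intro x hx
    have h1 : ‖x - p‖ ≤ 1 := by rwa [← dist_eq_norm, dist_comm]
    have h2 : ‖x - p‖ ^ 2 ≤ 1 := pow_le_one₀ (norm_nonneg _) h1
    by_contra! h
    nlinarith [hA x, sq_nonneg ‖P x‖]
  have hpos : 0 < α + β + γ + δ := by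
    have ha := mul_le_of_le_one_right hα (hσle a hpa)
    have hb := mul_le_of_le_one_right hβ (hσle b hpb)
    have hc := mul_le_of_le_one_right hγ (hσle c hpc)
    have hd := mul_le_of_le_one_right hδ (hσle d hpd)
    linarith
  -- squared-distance facts
  have hdn : ∀ x y : EuclideanSpace ℝ (Fin 3), dist y x = ‖x - y‖ := fun x y => by
    rw [dist_eq_norm, norm_sub_rev]
  have hsqA : ∀ x, 55 / 57 ≤ dist p x → dist p x ≤ 1 →
      (55 / 57 : ℝ) ^ 2 ≤ ‖x - p‖ ^ 2 ∧ ‖x - p‖ ^ 2 ≤ 1 := by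
    intro x h1 h2
    rw [hdn] at h1 h2
    exact ⟨pow_le_pow_left₀ (by norm_num) h1 2, pow_le_one₀ (by linarith) h2⟩
  have hsqB : ∀ x, 55 / 57 ≤ dist q x → (55 / 57 : ℝ) ^ 2 ≤ ‖x - q‖ ^ 2 := by
    intro x h1
    rw [hdn] at h1
    exact pow_le_pow_left₀ (by norm_num) h1 2
  have hsqD : ∀ x y : EuclideanSpace ℝ (Fin 3), dist x y ≤ 1 →
      ‖x - y‖ ^ 2 ≤ 1 ∧ ‖y - x‖ ^ 2 ≤ 1 := by
    intro x y h
    rw [dist_eq_norm] at h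
    exact ⟨pow_le_one₀ (norm_nonneg _) h, by rw [norm_sub_rev]; exact pow_le_one₀ (norm_nonneg _) h⟩
  obtain ⟨Aa1, Aa2⟩ := hsqA a lpa hpa
  obtain ⟨Ab1, Ab2⟩ := hsqA b lpb hpb
  obtain ⟨Ac1, Ac2⟩ := hsqA c lpc hpc
  obtain ⟨Ad1, Ad2⟩ := hsqA d lpd hpd
  obtain ⟨Dab, Dba⟩ := hsqD a b hab
  obtain ⟨Dbc, Dcb⟩ := hsqD b c hbc
  obtain ⟨Dcd, Ddc⟩ := hsqD c d hcd
  obtain ⟨Dda, Dad⟩ := hsqD d a hda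
  -- Gram entries relative to `p`
  have hg : ∀ x, t * σ x = α * ⟪a - p, x - p⟫_ℝ + β * ⟪b - p, x - p⟫_ℝ + γ * ⟪c - p, x - p⟫_ℝ +
      δ * ⟪d - p, x - p⟫_ℝ := by
    intro x
    have h1 : t * σ x = ⟪q - p, x - p⟫_ℝ := by
      rw [hσ, hqp, real_inner_smul_left, real_inner_comm]
    rw [h1, hcone]
    simp only [inner_add_left, real_inner_smul_left]
  have hgeq : ∀ x y, 2 * ⟪x - p, y - p⟫_ℝ = ‖x - p‖ ^ 2 + ‖y - p‖ ^ 2 - ‖x - y‖ ^ 2 := by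
    intro x y
    have h1 : ‖(x - p) - (y - p)‖ ^ 2 = ‖x - p‖ ^ 2 - 2 * ⟪x - p, y - p⟫_ℝ + ‖y - p‖ ^ 2 :=
      norm_sub_sq_real _ _
    rw [sub_sub_sub_cancel_right] at h1
    linarith
  have hg0 : ∀ x, 0 ≤ ⟪x - p, x - p⟫_ℝ := fun x => real_inner_self_nonneg
  have gab := hgeq a b; have gba := hgeq b a; have gbc := hgeq b c; have gcb := hgeq c b
  have gcd := hgeq c d; have gdc := hgeq d c; have gda := hgeq d a; have gad := hgeq a d
  have gaa := hg0 a; have gbb := hg0 b; have gcc := hg0 c; have gdd := hg0 d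
  -- the two diagonal Gram entries cannot both be very negative: `|a - b + c - d|² ≥ 0`
  have hdiag : 2 * (55 / 57 : ℝ) ^ 2 - 2 ≤ ⟪a - p, c - p⟫_ℝ + ⟪b - p, d - p⟫_ℝ := by
    have h0 : 0 ≤ ‖((a - p) - (b - p)) + ((c - p) - (d - p))‖ ^ 2 := sq_nonneg _
    rw [norm_add_sq_real, inner_sub_left (a - p) (b - p), inner_sub_right (a - p) (c - p) (d - p),
      inner_sub_right (b - p) (c - p) (d - p), norm_sub_sq_real (a - p) (b - p),
      norm_sub_sq_real (c - p) (d - p)] at h0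
    linarith only [h0, gab, gbc, gcd, gad, Aa1, Ab1, Ac1, Ad1, Dab, Dbc, Dcd, Dad]
  have hca : ⟪c - p, a - p⟫_ℝ = ⟪a - p, c - p⟫_ℝ := real_inner_comm _ _
  have hdb : ⟪d - p, b - p⟫_ℝ = ⟪b - p, d - p⟫_ℝ := real_inner_comm _ _
  -- side Gram entries are at least `lo = (2 (55/57)² - 1) / 2`
  obtain ⟨lo, hl⟩ : ∃ lo : ℝ, lo = (2 * (55 / 57 : ℝ) ^ 2 - 1) / 2 := ⟨_, rfl⟩
  have hlo : 0 < lo := by rw [hl]; norm_num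
  have hBl : (2 - 2 * (55 / 57 : ℝ) ^ 2) ^ 2 < 4 * lo ^ 2 := by rw [hl]; norm_num
  have Lba : lo ≤ ⟪b - p, a - p⟫_ℝ := by linarith only [hl, gba, Ab1, Aa1, Dba]
  have Lda : lo ≤ ⟪d - p, a - p⟫_ℝ := by linarith only [hl, gda, Ad1, Aa1, Dda]
  have Lab : lo ≤ ⟪a - p, b - p⟫_ℝ := by linarith only [hl, gab, Aa1, Ab1, Dab]
  have Lcb : lo ≤ ⟪c - p, b - p⟫_ℝ := by linarith only [hl, gcb, Ac1, Ab1, Dcb]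
  have Lbc : lo ≤ ⟪b - p, c - p⟫_ℝ := by linarith only [hl, gbc, Ab1, Ac1, Dbc]
  have Ldc : lo ≤ ⟪d - p, c - p⟫_ℝ := by linarith only [hl, gdc, Ad1, Ac1, Ddc]
  have Lad : lo ≤ ⟪a - p, d - p⟫_ℝ := by linarith only [hl, gad, Aa1, Ad1, Dad]
  have Lcd : lo ≤ ⟪c - p, d - p⟫_ℝ := by linarith only [hl, gcd, Ac1, Ad1, Dcd]
  -- the expansions `t σ_x = Σ w ⟪· - p, x - p⟫`
  have ka := hg a; have kb := hg b; have kc := hg c; have kd := hg d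
  -- no side has both axial coordinates negative
  have nab : ¬ (σ a < 0 ∧ σ b < 0) := by
    rintro ⟨h1, h2⟩
    have k1 : t * σ a < 0 := mul_neg_of_pos_of_neg htpos h1
    have k2 : t * σ b < 0 := mul_neg_of_pos_of_neg htpos h2
    refine cross_neg_false (w₁ := γ) (w₂ := δ) (X := -⟪c - p, a - p⟫_ℝ) (Y := -⟪d - p, b - p⟫_ℝ)
      hlo hγ hδ ?_ ?_ (by linarith only [hdiag, hca, hdb]) hBl
    · linarith only [k1, ka, mul_nonneg hα gaa, mul_le_mul_of_nonneg_left Lba hβ,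
        mul_le_mul_of_nonneg_left Lda hδ, mul_nonneg hβ hlo.le]
    · linarith only [k2, kb, mul_le_mul_of_nonneg_left Lab hα, mul_nonneg hβ gbb,
        mul_le_mul_of_nonneg_left Lcb hγ, mul_nonneg hα hlo.le]
  have nbc : ¬ (σ b < 0 ∧ σ c < 0) := by
    rintro ⟨h1, h2⟩
    have k1 : t * σ b < 0 := mul_neg_of_pos_of_neg htpos h1
    have k2 : t * σ c < 0 := mul_neg_of_pos_of_neg htpos h2
    refine cross_neg_false (w₁ := δ) (w₂ := α) (X := -⟪d - p, b - p⟫_ℝ) (Y := -⟪a - p, c - p⟫_ℝ)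
      hlo hδ hα ?_ ?_ (by linarith only [hdiag, hdb]) hBl
    · linarith only [k1, kb, mul_le_mul_of_nonneg_left Lab hα, mul_nonneg hβ gbb,
        mul_le_mul_of_nonneg_left Lcb hγ, mul_nonneg hγ hlo.le]
    · linarith only [k2, kc, mul_le_mul_of_nonneg_left Lbc hβ, mul_nonneg hγ gcc,
        mul_le_mul_of_nonneg_left Ldc hδ, mul_nonneg hβ hlo.le]
  have ncd : ¬ (σ c < 0 ∧ σ d < 0) := by
    rintro ⟨h1, h2⟩
    have k1 : t * σ c < 0 := mul_neg_of_pos_of_neg htpos h1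
    have k2 : t * σ d < 0 := mul_neg_of_pos_of_neg htpos h2
    refine cross_neg_false (w₁ := α) (w₂ := β) (X := -⟪a - p, c - p⟫_ℝ) (Y := -⟪b - p, d - p⟫_ℝ)
      hlo hα hβ ?_ ?_ (by linarith only [hdiag]) hBl
    · linarith only [k1, kc, mul_le_mul_of_nonneg_left Lbc hβ, mul_nonneg hγ gcc,
        mul_le_mul_of_nonneg_left Ldc hδ, mul_nonneg hδ hlo.le]
    · linarith only [k2, kd, mul_le_mul_of_nonneg_left Lad hα, mul_nonneg hδ gdd,
        mul_le_mul_of_nonneg_left Lcd hγ, mul_nonneg hγ hlo.le]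
  have nda : ¬ (σ d < 0 ∧ σ a < 0) := by
    rintro ⟨h1, h2⟩
    have k1 : t * σ d < 0 := mul_neg_of_pos_of_neg htpos h1
    have k2 : t * σ a < 0 := mul_neg_of_pos_of_neg htpos h2
    refine cross_neg_false (w₁ := β) (w₂ := γ) (X := -⟪b - p, d - p⟫_ℝ) (Y := -⟪c - p, a - p⟫_ℝ)
      hlo hβ hγ ?_ ?_ (by linarith only [hdiag, hca]) hBl
    · linarith only [k1, kd, mul_le_mul_of_nonneg_left Lad hα, mul_nonneg hδ gdd,
        mul_le_mul_of_nonneg_left Lcd hγ, mul_nonneg hα hlo.le]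
    · linarith only [k2, ka, mul_nonneg hα gaa, mul_le_mul_of_nonneg_left Lba hβ,
        mul_le_mul_of_nonneg_left Lda hδ, mul_nonneg hδ hlo.le]
  -- consecutive transversal parts make acute angles
  have cab : 0 < ⟪P a, P b⟫_ℝ := side_inner_pos hpq hlt Aa1 Ab1 Ab2 (hsqB a lqa) (hsqB b lqb)
    Dab (h2σ a) (h2σ b) nab (hip a b)
  have cbc : 0 < ⟪P b, P c⟫_ℝ := side_inner_pos hpq hlt Ab1 Ac1 Ac2 (hsqB b lqb) (hsqB c lqc)
    Dbc (h2σ b) (h2σ c) nbc (hip b c)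
  have ccd : 0 < ⟪P c, P d⟫_ℝ := side_inner_pos hpq hlt Ac1 Ad1 Ad2 (hsqB c lqc) (hsqB d lqd)
    Dcd (h2σ c) (h2σ d) ncd (hip c d)
  have cda : 0 < ⟪P d, P a⟫_ℝ := side_inner_pos hpq hlt Ad1 Aa1 Aa2 (hsqB d lqd) (hsqB a lqa)
    Dda (h2σ d) (h2σ a) nda (hip d a)
  -- the plane `e^⊥` is isometric to `ℂ`
  have he0 : e ≠ 0 := fun h => by
    rw [h, norm_zero] at he1
    exact zero_ne_one he1
  haveI : Fact (Module.finrank ℝ (EuclideanSpace ℝ (Fin 3)) = 2 + 1) :=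
    ⟨by rw [finrank_euclideanSpace_fin]⟩
  let Φ : (ℝ ∙ e)ᗮ ≃ₗᵢ[ℝ] ℂ :=
    (Complex.isometryOfOrthonormal (OrthonormalBasis.fromOrthogonalSpanSingleton 2 he0)).symm
  have hmemK : ∀ x, P x ∈ (ℝ ∙ e)ᗮ := fun x =>
    Submodule.mem_orthogonal_singleton_iff_inner_left.mpr (hPe x)
  obtain ⟨z, hz⟩ : ∃ z : EuclideanSpace ℝ (Fin 3) → ℂ, ∀ x, z x = Φ ⟨P x, hmemK x⟩ :=
    ⟨fun x => Φ ⟨P x, hmemK x⟩, fun _ => rfl⟩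
  have hzi : ∀ x y, (z x).re * (z y).re + (z x).im * (z y).im = ⟪P x, P y⟫_ℝ := by
    intro x y
    have h1 : ⟪z x, z y⟫_ℝ = ⟪P x, P y⟫_ℝ := by
      rw [hz, hz, LinearIsometryEquiv.inner_map_map, Submodule.coe_inner, Submodule.coe_mk,
        Submodule.coe_mk]
    rw [← h1, Complex.inner, Complex.mul_re, Complex.conj_re, Complex.conj_im]
    ring
  -- the projected cone relation in coordinates
  have hK : α • (⟨P a, hmemK a⟩ : (ℝ ∙ e)ᗮ) + β • ⟨P b, hmemK b⟩ + γ • ⟨P c, hmemK c⟩ +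
      δ • ⟨P d, hmemK d⟩ = 0 := by
    apply Subtype.ext
    simp only [Submodule.coe_add, Submodule.coe_smul, Submodule.coe_zero]
    exact hV0
  have hzrel : α • z a + β • z b + γ • z c + δ • z d = 0 := by
    rw [hz, hz, hz, hz, ← map_smul, ← map_smul, ← map_smul, ← map_smul, ← map_add, ← map_add,
      ← map_add, hK, map_zero]
  have hre : α * (z a).re + β * (z b).re + γ * (z c).re + δ * (z d).re = 0 := by
    have h1 := congr_arg Complex.re hzrel
    simpa only [Complex.add_re, Complex.smul_re, smul_eq_mul, Complex.zero_re] using h1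
  have him : α * (z a).im + β * (z b).im + γ * (z c).im + δ * (z d).im = 0 := by
    have h1 := congr_arg Complex.im hzrel
    simpa only [Complex.add_im, Complex.smul_im, smul_eq_mul, Complex.zero_im] using h1
  -- conclude in the plane
  refine planar_four_cone_false (z a).re (z a).im (z b).re (z b).im (z c).re (z c).im
    (z d).re (z d).im α β γ δ hα hβ hγ hδ hpos hre him ?_ ?_ ?_ ?_
  · rw [hzi]; exact cab
  · rw [hzi]; exact cbc
  · rw [hzi]; exact ccd
  · rw [hzi]; exact cda

/-- **Triangular faces** (`d = c` in `le_dist_of_cone_four_cycle`): a point in the closed cone of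
`p` over a bonded link triangle `abc`, at distance `≥ 55/57` from `a, b, c` and `> 1` from `p`, is
at distance `≥ 131/100` from `p` (numerically `≥ 1.55`). [folklore] -/
theorem le_dist_of_cone_triangle (p q a b c : EuclideanSpace ℝ (Fin 3)) (α β γ : ℝ)
    (hα : 0 ≤ α) (hβ : 0 ≤ β) (hγ : 0 ≤ γ)
    (hcone : q - p = α • (a - p) + β • (b - p) + γ • (c - p)) (hpq : 1 < dist p q)
    (hpa : dist p a ≤ 1) (hpb : dist p b ≤ 1) (hpc : dist p c ≤ 1)
    (lpa : 55 / 57 ≤ dist p a) (lpb : 55 / 57 ≤ dist p b) (lpc : 55 / 57 ≤ dist p c)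
    (hab : dist a b ≤ 1) (hbc : dist b c ≤ 1) (hca : dist c a ≤ 1)
    (lqa : 55 / 57 ≤ dist q a) (lqb : 55 / 57 ≤ dist q b) (lqc : 55 / 57 ≤ dist q c) :
    131 / 100 ≤ dist p q :=
  le_dist_of_cone_four_cycle p q a b c c α β γ 0 hα hβ hγ le_rfl
    (by rw [hcone, zero_smul, add_zero]) hpq hpa hpb hpc hpc lpa lpb lpc lpc hab hbc
    (by rw [dist_self]; norm_num) hca lqa lqb lqc lqc

/-! ## The reduction of `stub_extendedGap` to the link-cone cover -/

/-- **`stub_extendedGap` from `LinkConesCover`.**  HYPOTHESIS (`LinkConesCover`, the multi-shell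
core, to be registered as the open stub): if every site within `4` of `x i` is Good, then every
site `x j` with `1 < |x i − x j| < 2` lies in the closed cone of `x i` over a bonded closed 4-walk
`a b c d` of the link of `i` (`a, b, c, d ≠ i` within `1` of `x i`, `|ab|, |bc|, |cd|, |da| ≤ 1`;
`d = c` for a triangular face).  CONCLUSION: the registered signature of `stub_extendedGap`
verbatim.  Proof: Good(`i`) alone gives `|x i − x a| ≥ 55/57` and `|x j − x a| ≥ 55/57` for the
four vertices, and `le_dist_of_cone_four_cycle` applies. [folklore] -/
theorem extendedGap_of_linkConesCover
    (hcover : ∀ (N : ℕ) (x : Fin N → EuclideanSpace ℝ (Fin 3)) (i : Fin N),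
      (∀ l : Fin N, dist (x i) (x l) ≤ 4 →
        ((∀ j' : Fin N, dist (x l) (x j') ≤ 11 / 10 → ∀ k : Fin N, k ≠ j' →
            (55 : ℝ) / 57 ≤ dist (x j') (x k)) ∧
          (Finset.univ.filter fun j' : Fin N => j' ≠ l ∧ dist (x l) (x j') ≤ 1).card = 12 ∧
          (Finset.univ.filter fun j' : Fin N => j' ≠ l ∧ dist (x l) (x j') ≤ 11 / 10).card ≤ 12)) →
      ∀ j : Fin N, 1 < dist (x i) (x j) → dist (x i) (x j) < 2 →
        ∃ a b c d : Fin N, a ≠ i ∧ b ≠ i ∧ c ≠ i ∧ d ≠ i ∧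
          dist (x i) (x a) ≤ 1 ∧ dist (x i) (x b) ≤ 1 ∧ dist (x i) (x c) ≤ 1 ∧
          dist (x i) (x d) ≤ 1 ∧ dist (x a) (x b) ≤ 1 ∧ dist (x b) (x c) ≤ 1 ∧
          dist (x c) (x d) ≤ 1 ∧ dist (x d) (x a) ≤ 1 ∧
          ∃ α β γ δ : ℝ, 0 ≤ α ∧ 0 ≤ β ∧ 0 ≤ γ ∧ 0 ≤ δ ∧
            x j - x i = α • (x a - x i) + β • (x b - x i) + γ • (x c - x i) + δ • (x d - x i)) :
    ∀ (N : ℕ) (x : Fin N → EuclideanSpace ℝ (Fin 3)) (i j : Fin N),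
      (∀ l : Fin N, dist (x i) (x l) ≤ 4 →
        ((∀ j' : Fin N, dist (x l) (x j') ≤ 11 / 10 → ∀ k : Fin N, k ≠ j' →
            (55 : ℝ) / 57 ≤ dist (x j') (x k)) ∧
          (Finset.univ.filter fun j' : Fin N => j' ≠ l ∧ dist (x l) (x j') ≤ 1).card = 12 ∧
          (Finset.univ.filter fun j' : Fin N => j' ≠ l ∧ dist (x l) (x j') ≤ 11 / 10).card ≤ 12)) →
      1 < dist (x i) (x j) → (131 : ℝ) / 100 ≤ dist (x i) (x j) := by
  intro N x i j hgood h1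
  by_contra! hlt
  obtain ⟨a, b, c, d, hai, hbi, hci, hdi, hia, hib, hic, hid, hab, hbc, hcd, hda, α, β, γ, δ,
    hα, hβ, hγ, hδ, hv⟩ := hcover N x i hgood j h1 (by linarith)
  have hGi := (hgood i (by rw [dist_self]; norm_num)).1
  have hsep : ∀ k : Fin N, k ≠ i → (55 : ℝ) / 57 ≤ dist (x i) (x k) :=
    hGi i (by rw [dist_self]; norm_num)
  have hja : ∀ a' : Fin N, dist (x i) (x a') ≤ 1 → (55 : ℝ) / 57 ≤ dist (x j) (x a') := by
    intro a' ha'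
    have hne : j ≠ a' := by
      rintro rfl
      linarith
    rw [dist_comm]
    exact hGi a' (by linarith) j hne
  have := le_dist_of_cone_four_cycle (x i) (x j) (x a) (x b) (x c) (x d) α β γ δ hα hβ hγ hδ hv
    h1 hia hib hic hid (hsep a hai) (hsep b hbi) (hsep c hci) (hsep d hdi) hab hbc hcd hda
    (hja a hia) (hja b hib) (hja c hic) (hja d hid)
  linarith

/-- Registered anchor: `LinkConesCover → stub_extendedGap` (both closed, verbatim). [folklore] -/
theorem stub_extendedGapOfLinkConesCover :
    (∀ (N : ℕ) (x : Fin N → EuclideanSpace ℝ (Fin 3)) (i : Fin N),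
      (∀ l : Fin N, dist (x i) (x l) ≤ 4 →
        ((∀ j' : Fin N, dist (x l) (x j') ≤ 11 / 10 → ∀ k : Fin N, k ≠ j' →
            (55 : ℝ) / 57 ≤ dist (x j') (x k)) ∧
          (Finset.univ.filter fun j' : Fin N => j' ≠ l ∧ dist (x l) (x j') ≤ 1).card = 12 ∧
          (Finset.univ.filter fun j' : Fin N => j' ≠ l ∧ dist (x l) (x j') ≤ 11 / 10).card ≤ 12)) →
      ∀ j : Fin N, 1 < dist (x i) (x j) → dist (x i) (x j) < 2 →
        ∃ a b c d : Fin N, a ≠ i ∧ b ≠ i ∧ c ≠ i ∧ d ≠ i ∧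
          dist (x i) (x a) ≤ 1 ∧ dist (x i) (x b) ≤ 1 ∧ dist (x i) (x c) ≤ 1 ∧
          dist (x i) (x d) ≤ 1 ∧ dist (x a) (x b) ≤ 1 ∧ dist (x b) (x c) ≤ 1 ∧
          dist (x c) (x d) ≤ 1 ∧ dist (x d) (x a) ≤ 1 ∧
          ∃ α β γ δ : ℝ, 0 ≤ α ∧ 0 ≤ β ∧ 0 ≤ γ ∧ 0 ≤ δ ∧
            x j - x i = α • (x a - x i) + β • (x b - x i) + γ • (x c - x i) + δ • (x d - x i)) →
    ∀ (N : ℕ) (x : Fin N → EuclideanSpace ℝ (Fin 3)) (i j : Fin N),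
      (∀ l : Fin N, dist (x i) (x l) ≤ 4 →
        ((∀ j' : Fin N, dist (x l) (x j') ≤ 11 / 10 → ∀ k : Fin N, k ≠ j' →
            (55 : ℝ) / 57 ≤ dist (x j') (x k)) ∧
          (Finset.univ.filter fun j' : Fin N => j' ≠ l ∧ dist (x l) (x j') ≤ 1).card = 12 ∧
          (Finset.univ.filter fun j' : Fin N => j' ≠ l ∧ dist (x l) (x j') ≤ 11 / 10).card ≤ 12)) →
      1 < dist (x i) (x j) → (131 : ℝ) / 100 ≤ dist (x i) (x j) :=
  extendedGap_of_linkConesCover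

end Summit.AtomisticToContinuum.Crystallization.Theorems.SquareWellLayerCakeGapTwelveToBarlow
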